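import Literature.Probability.Percolation.QuadCrossingContinuityCaseTwoTame
import Literature.Probability.Percolation.QuadCrossingContinuityCaseThreeSmall
import HarnessLib

/-!
# Schramm–Smirnov Lemma 6.1, case (2), for tame quads: all sub-cases in terms of `d = max{d₀, d₁}`

Topic `Probability/Percolation`; proofs file towards the named fact `SchrammSmirnov2011_lemma_6_1`
(`QuadCrossingContinuity.lean`; O. Schramm, S. Smirnov, *On the scaling limits of planar
percolation*, Ann. Probab. 39 (2011), arXiv:1101.5820, Lemma 6.1 and its proof, pp. 21–23:
"Now we are ready to prove the estimate, working out separately three possibilities: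
(i) `d = d₁`, (ii) `d = d₀ > δ ≥ d₁`, (iii) `d = d₀ > d₁ > δ`.  When (i) occurs, we majorate the
probability of the event in question by the maximum of its conditional probability … When (ii)
occurs, we use the estimate (6.1) … Finally, when (iii) occurs, we apply the total expectation law,
using both estimates (6.2) and (6.1) along the way: `P(⊞_{Q'} ∖ ⊞_Q) ≤ 2 P(⊞_{Q'}) Δ₁(δ, d₁/2)
≤ 2 Δ₁(2d₁, d/4) Δ₁(δ, d₁/2)`").

`real_symmDiff_crossedEvent_le_of_isPerturbationTwo_of_tame_all` assembles the case-(2) estimate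
of Lemma 6.1 for critical bond percolation on `δℤ²` in the scale-free form
`μ_η(⊞_Q Δ ⊞_{Q'}) ≤ 2 (C K ρ / d(Q))^α` (`d(Q) = Quad.sizeParam Q = max{d₀, d₁}`, all meshes
`η < ρ`, regime `K ρ ≤ c d(Q)`), from

* sub-case (ii), `d₁` small (`QuadCrossingContinuityCaseTwoSmall.lean`, general quads);
* the new sub-case `d₀ ≤ ρ` (`real_symmDiff_crossedEvent_le_of_isPerturbationTwo_of_sideDist_zero_le`,
  general quads, no exploration: a junction of `∂₀Q` to `∂₂Q` of diameter `< 2ρ` meets every dual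
  separator of `Q`, which therefore contains a closed dual arm about a FIXED point from `≈ 2ρ` to
  `≈ d₁/8`; RSW) — needed because the lowest-crossing theorem asks `ρ < d₀(Q)`;
* the lowest-crossing theorem for tame quads in its product form
  (`measureReal_symmDiff_le_mul_of_isPerturbationTwo_of_tame`, `QuadCrossingContinuityCaseTwoTame.lean`),
  which covers (i) and, multiplied by the a-priori bound `P(⊞_{Q'}) ≤ (C d₁/d₀)^α` of eq. (6.1)
  (`Quad.mem_annulusOpenCrossing_of_isCrossing_inner`), covers (iii); with the power laws of the
  tree the printed two-scale discussion of (iii) collapses to `(d₁/d)^α (ρ/d₁)^α = (ρ/d)^α`.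

The tameness hypotheses (`htame`, `harc`, `hstar`, `hcut` — see `QuadCrossingContinuityCaseTwoTame.lean`)
are those of the lowest-crossing theorem and are used only in the sub-cases that need it.
Everything is proved; the named fact itself (all quads) is not discharged by this file.

## References

* O. Schramm, S. Smirnov, Ann. Probab. 39 (2011) 1768–1814, arXiv:1101.5820, Lemma 6.1 and its
  proof, eq. (6.1)–(6.5). [SchrammSmirnov2011]
* G. Grimmett, *Percolation*, 2nd ed. (1999), §11.7–11.8 (RSW at `p = 1/2`). [GrimmettPercolation1999]
-/

noncomputable section

open scoped unitInterval
open Set Filter Metric Function MeasureTheory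
open _root_.Topology
open Literature.Probability.LatticeModels

namespace Literature.Probability.Percolation

namespace QuadCrossing

variable {D : Set ℂ}

/-! ### Reparametrising a path between two arbitrary times -/

/-- The piece of a path on `[0,1]` between two times `a, b ∈ [0,1]` (in either order),
reparametrised by `[0,1]`. [folklore] -/
theorem exists_reparam_between {γ : ℝ → ℂ} (hγ : ContinuousOn γ (Icc 0 1)) {a b : ℝ}
    (ha : a ∈ Icc (0 : ℝ) 1) (hb : b ∈ Icc (0 : ℝ) 1) :
    ContinuousOn (fun t : ℝ => γ (a + t * (b - a))) (Icc 0 1) ∧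
      (fun t : ℝ => γ (a + t * (b - a))) 0 = γ a ∧ (fun t : ℝ => γ (a + t * (b - a))) 1 = γ b ∧
      ∀ t ∈ Icc (0 : ℝ) 1, a + t * (b - a) ∈ Icc (0 : ℝ) 1 := by
  have hmaps : ∀ t ∈ Icc (0 : ℝ) 1, a + t * (b - a) ∈ Icc (0 : ℝ) 1 := fun t ht => by
    constructor
    · nlinarith [ht.1, ht.2, ha.1, hb.1]
    · nlinarith [ht.1, ht.2, ha.2, hb.2]
  refine ⟨hγ.comp (by fun_prop) fun t ht => hmaps t ht, by simp, by simp, hmaps⟩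

/-! ### Monotonicity of condition (2) in the perturbation size -/

/-- Condition (2) at scale `δ` implies condition (2) at any larger scale. [cite: SchrammSmirnov2011, Lemma 6.1 (2)] -/
theorem Quad.IsPerturbationTwo.mono {Q Q' : Quad D} {δ δ' : ℝ} (h : Q.IsPerturbationTwo Q' δ)
    (hδ : δ ≤ δ') : Q.IsPerturbationTwo Q' δ' := by
  obtain ⟨hcar, h0, h1, h3, hjoin⟩ := h
  refine ⟨hcar, h0, h1, h3, fun x hx => ?_⟩
  obtain ⟨y, hy, α, hα, hαd⟩ := hjoin x hx
  exact ⟨y, hy, α, hα, hαd.trans hδ⟩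

/-! ### Sub-case `d₀(Q) ≤ ρ`: a closed arm about a fixed point -/

/-- **A short junction of `∂₀Q` to `∂₂Q` sees every dual separator.**  Let `τ` be a path in `[Q]`
from `x₀ ∈ ∂₀Q` to `∂₂Q` with `diam τ < r`, and let `r + 2δ ≤ R`, `4R < d₁(Q)`.  If `Q` has no
crossing inside the drawn open edges of `δℤ²` (`δ > 0`), then
`ω ∈ annulusDualCrossing x₀ δ (r + 2δ) (R - 2δ)`: the dual path `β` of `Q` from `∂₁Q` to `∂₃Q`
(off the open edges) meets `τ`, hence passes within `r` of `x₀`; it has diameter `≥ d₁(Q) > 4R`,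
so it reaches distance `≥ R` from `x₀`; the piece from the meeting point to the first such time is
shadowed by a dual-open chain of faces.
[cite: SchrammSmirnov2011, proof of Lemma 6.1, case (2)] -/
theorem Quad.mem_annulusDualCrossing_of_not_exists_isCrossing_of_junction {Q : Quad D} {δ : ℝ}
    (hδ : 0 < δ) {ω : BondConfig (Site 2)} {x₀ x₂ : ℂ} (hx₀ : x₀ ∈ Q.side 0) (hx₂ : x₂ ∈ Q.side 2)
    (τ : Path x₀ x₂) (hτ : range τ ⊆ Q.carrier) {r : ℝ} (hτr : Metric.diam (range τ) < r)
    {R : ℝ} (hrR : r + 2 * δ ≤ R) (hR : 4 * R < Q.sideDist 1)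
    (hnot : ¬ ∃ K, Q.IsCrossing K ∧ K ⊆ openEdgeUnion δ ω) :
    ω ∈ annulusDualCrossing x₀ δ (r + 2 * δ) (R - 2 * δ) := by
  -- the dual path of `Q`
  obtain ⟨β, hβc, hβQ, hβ0, hβ1, hβO⟩ := Q.exists_path_avoiding_of_not_exists_isCrossing hδ hnot
  -- it meets `τ`
  have hτc : IsCompact (range τ) := isCompact_range τ.continuous
  have hτconn : IsPreconnected (range τ) := (isPreconnected_range τ.continuous)
  obtain ⟨s, hs, hsτ⟩ := Q.exists_mem_of_isPreconnected_crossing hτc hτconn hτ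
    ⟨x₀, ⟨0, τ.source⟩, hx₀⟩ ⟨x₂, ⟨1, τ.target⟩, hx₂⟩ hβc hβQ hβ0 hβ1
  have hsx : dist (β s) x₀ < r :=
    (dist_le_diam_of_mem hτc.isBounded hsτ ⟨0, τ.source⟩).trans_lt hτr
  -- some point of `β` is at distance `≥ R` from `x₀`
  have hfar : ∃ t ∈ Icc (0 : ℝ) 1, R ≤ dist (β t) x₀ := by
    by_contra hcon
    push Not at hcon
    obtain ⟨p, hp⟩ := exists_path_of_continuousOn hβc
    have hprange : range p ⊆ β '' Icc 0 1 := by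
      rintro _ ⟨t, rfl⟩; exact ⟨t, t.2, (hp t).symm⟩
    have hpQ : range p ⊆ Q.carrier := hprange.trans (by rintro _ ⟨t, ht, rfl⟩; exact hβQ ht)
    have hdiam := Quad.sideDist_le (Q := Q) (j := 1) hβ0 hβ1 p hpQ
    have hbound : Metric.diam (range p) ≤ 2 * R := by
      have hR0 : 0 ≤ R := by linarith [Metric.diam_nonneg (s := range τ)]
      refine Metric.diam_le_of_forall_dist_le (by linarith) ?_
      rintro _ ⟨u, rfl⟩ _ ⟨v, rfl⟩
      rw [hp u, hp v]
      have hu := hcon u u.2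
      have hv := hcon v v.2
      linarith [dist_triangle (β u) x₀ (β v), dist_comm x₀ (β v)]
    linarith [Metric.diam_nonneg (s := range τ)]
  obtain ⟨t₁, ht₁, ht₁far⟩ := hfar
  -- the piece of `β` from `s` to `t₁`
  obtain ⟨hγc, hγ0, hγ1, hγmaps⟩ := exists_reparam_between hβc hs ht₁
  set γ : ℝ → ℂ := fun t => β (s + t * (t₁ - s)) with hγ
  have h0 : dist (γ 0) x₀ < R := by rw [hγ0]; linarith
  have h1 : R ≤ dist (γ 1) x₀ := by rw [hγ1]; exact ht₁far
  obtain ⟨γ', hγ'c, hγ'0, hγ'mem, hγ'R, hγ'1⟩ := exists_restrict_until_dist_ge hγc h0 h1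
  have hγ'O : ∀ t ∈ Icc (0 : ℝ) 1, γ' t ∉ openEdgeUnion δ ω := fun t ht => by
    obtain ⟨u, hu, hu'⟩ := hγ'mem t ht
    rw [← hu']
    exact (hβO _ (hγmaps u hu)).1
  have h0' : dist (γ' 0) x₀ ≤ r := by rw [hγ'0, hγ0]; exact hsx.le
  exact mem_annulusDualCrossing_of_path hδ x₀ hγ'c hγ'O h0' hγ'R hγ'1 hrR

/-- **Lemma 6.1, case (2), sub-case `d₀(Q) ≤ ρ`**, for critical bond percolation on `δℤ²` and
GENERAL quads: there are `α, C, c > 0` such that whenever `Q.IsPerturbationTwo Q' ρ`,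
`0 < ρ ≤ c · d₁(Q)` and `d₀(Q) ≤ ρ`, then for every mesh `0 < η < ρ`,
`μ_η(⊞_Q Δ ⊞_{Q'}) ≤ (C ρ / d₁(Q))^α`.  Proof: `⊞_Q ⊆ ⊞_{Q'}`, so the symmetric difference lies in
`¬⊞_Q`; a junction of `∂₀Q` to `∂₂Q` of diameter `< 2ρ` exists, and by
`Quad.mem_annulusDualCrossing_of_not_exists_isCrossing_of_junction` the event `¬⊞_Q` is inside a
closed annulus crossing about its (deterministic) foot from radius `≈ 2ρ` to `≈ d₁/8`; RSW.
(In the printed case analysis this is part of (i), `d = d₁`; the lowest crossing is not needed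
here.) [cite: SchrammSmirnov2011, proof of Lemma 6.1, case (2)] -/
theorem real_symmDiff_crossedEvent_le_of_isPerturbationTwo_of_sideDist_zero_le :
    ∃ α C c : ℝ, 0 < α ∧ 0 < C ∧ 0 < c ∧
      ∀ (D : Set ℂ) (Q Q' : Quad D) (ρ : ℝ), 0 < ρ → ρ ≤ c * Q.sideDist 1 →
        Q.IsPerturbationTwo Q' ρ → Q.sideDist 0 ≤ ρ →
          ∀ η : ℝ, 0 < η → η < ρ →
            (squareCrossingLaw D η : Measure (QuadConfig D)).real
                (symmDiff (QuadConfig.crossedEvent Q) (QuadConfig.crossedEvent Q')) ≤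
              (C * ρ / Q.sideDist 1) ^ α := by
  obtain ⟨α, c₀, hα, hc₀, hRSW⟩ := annulusDualCrossing_half_le_holds
  set C₁ : ℝ := 6 + 2 * c₀ with hC₁
  have hC₁pos : 0 < C₁ := by rw [hC₁]; linarith
  refine ⟨α, 16 * C₁, 1 / (64 * (C₁ + 1)), hα, by positivity, by positivity, ?_⟩
  intro D Q Q' ρ hρ hρc h2 hd0 η hη hηρ
  obtain ⟨hcar, h0, h1, h3, hjoin⟩ := h2
  set d₁ := Q.sideDist 1 with hd₁
  have hd₁pos : 0 < d₁ := Q.sideDist_pos 1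
  -- the regime: `ρ ≤ d₁ / (64 (C₁ + 1))`
  have hρd : 64 * (C₁ + 1) * ρ ≤ d₁ := by
    have := hρc
    rw [div_mul_eq_mul_div, one_mul, le_div_iff₀ (by positivity)] at this
    linarith
  -- the mesh `δ' = η √2 < 2ρ`
  set δ' : ℝ := η * Real.sqrt 2 with hδ'
  have hδ'pos : 0 < δ' := mul_pos hη (Real.sqrt_pos.2 (by norm_num))
  have hsqrt2 : Real.sqrt 2 < 2 := by
    rw [show (2 : ℝ) = Real.sqrt 4 by rw [show (4 : ℝ) = 2 ^ 2 by norm_num, Real.sqrt_sq (by norm_num)]]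
    exact Real.sqrt_lt_sqrt (by norm_num) (by norm_num)
  have hδ'ρ : δ' < 2 * ρ := by
    calc δ' = η * Real.sqrt 2 := rfl
      _ < ρ * 2 := mul_lt_mul'' hηρ hsqrt2 hη.le (Real.sqrt_nonneg _)
      _ = 2 * ρ := by ring
  -- Step 1: the law is bounded by the `P_{1/2}`-probability of the symmetric difference
  refine (real_squareCrossingLaw_symmDiff_le D η Q Q').trans ?_
  -- Step 2: the discrete events; `⊞_Q ⊆ ⊞_{Q'}`, so the symmetric difference is inside `¬⊞_Q`
  set A : Set (BondConfig (Site 2)) := {ω | Q ∈ z2QuadConfig D δ' ω} with hA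
  set B : Set (BondConfig (Site 2)) := {ω | Q' ∈ z2QuadConfig D δ' ω} with hB
  set N : Set (BondConfig (Site 2)) := {ω | ¬ ∃ K, Q.IsCrossing K ∧ K ⊆ openEdgeUnion δ' ω} with hN
  have hAB : A ⊆ B := fun ω hω => by
    rw [hA, mem_setOf_eq, mem_z2QuadConfig_iff_exists_isCrossing hδ'pos] at hω
    obtain ⟨K, hK, hKO⟩ := hω
    obtain ⟨K', hK', hK'O⟩ := Quad.exists_isCrossing_subquad_of_isCrossing hcar h0 h1 h3 hδ'pos hK hKO
    rw [hB, mem_setOf_eq, mem_z2QuadConfig_iff_exists_isCrossing hδ'pos]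
    exact ⟨K', hK', hK'O⟩
  have hsymm : symmDiff A B ⊆ N := by
    intro ω hω
    have hωA : ω ∉ A := by
      rcases (Set.mem_symmDiff).1 hω with ⟨hωA, hnB⟩ | ⟨-, hnA⟩
      · exact absurd (hAB hωA) hnB
      · exact hnA
    intro hK
    apply hωA
    rw [hA, mem_setOf_eq, mem_z2QuadConfig_iff_exists_isCrossing hδ'pos]
    exact hK
  -- Step 3: `¬⊞_Q` forces a closed arm about the foot of a short junction of `∂₀Q` to `∂₂Q`
  obtain ⟨x₀, hx₀, x₂, hx₂, τ, hτ, hτdiam⟩ := Quad.exists_transversal_zero_diam_lt Q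
  have hτ2ρ : Metric.diam (range τ) < 2 * ρ := by linarith
  set R : ℝ := d₁ / 8 with hR
  have hrR : 2 * ρ + 2 * δ' ≤ R := by rw [hR]; nlinarith [hC₁pos]
  have h4R : 4 * R < Q.sideDist 1 := by rw [hR, ← hd₁]; linarith
  set r'' : ℝ := max (2 * ρ + 2 * δ') (c₀ * δ') with hr''
  have hNE : N ⊆ annulusDualCrossing x₀ δ' r'' (R - 2 * δ') := fun ω hω =>
    annulusDualCrossing_mono_left x₀ δ' (le_max_left _ _) _
      (Quad.mem_annulusDualCrossing_of_not_exists_isCrossing_of_junction hδ'pos hx₀ hx₂ τ hτ hτ2ρ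
        hrR h4R hω)
  -- Step 4: RSW
  have hr''δ : c₀ * δ' ≤ r'' := le_max_right _ _
  have hr''le : r'' ≤ C₁ * ρ := by
    rw [hr'', max_le_iff, hC₁]
    constructor
    · nlinarith
    · nlinarith [hc₀]
  have hR'ge : d₁ / 16 ≤ R - 2 * δ' := by rw [hR]; nlinarith [hC₁pos]
  have h2r : 2 * r'' ≤ R - 2 * δ' := by nlinarith [hC₁pos]
  have hRSW' := hRSW x₀ δ' r'' (R - 2 * δ') hδ'pos hr''δ h2r
  -- Step 5: assemble
  have hmono : (bondPercolation (zdGraph 2) half).real (symmDiff A B) ≤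
      (bondPercolation (zdGraph 2) half).real (annulusDualCrossing x₀ δ' r'' (R - 2 * δ')) :=
    measureReal_mono (hsymm.trans hNE) (measure_ne_top _ _)
  refine hmono.trans (hRSW'.trans ?_)
  have hr''pos : 0 < r'' := lt_of_lt_of_le (by positivity) (le_max_left _ _)
  have hbase : r'' / (R - 2 * δ') ≤ 16 * C₁ * ρ / d₁ := by
    rw [div_le_div_iff₀ (by linarith) hd₁pos]
    calc r'' * d₁ ≤ C₁ * ρ * d₁ := by nlinarith
      _ = 16 * C₁ * ρ * (d₁ / 16) := by ring
      _ ≤ 16 * C₁ * ρ * (R - 2 * δ') := by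
          apply mul_le_mul_of_nonneg_left hR'ge; positivity
  have hr''nn : 0 ≤ r'' / (R - 2 * δ') := div_nonneg hr''pos.le (by linarith)
  exact Real.rpow_le_rpow hr''nn hbase hα.le

/-! ### All sub-cases of case (2), tame quads -/

/-! #### Arithmetic of the assembly -/

/-- `x^{αᵢ} ≤ 2 y^α` for `0 < x ≤ 1`, `x ≤ y`, `0 < α ≤ αᵢ`. [folklore] -/
theorem rpow_le_two_mul_rpow {x y α αi : ℝ} (hx0 : 0 < x) (hx1 : x ≤ 1) (hα : 0 < α)
    (hαi : α ≤ αi) (hxy : x ≤ y) : x ^ αi ≤ 2 * y ^ α := by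
  have h1 : x ^ αi ≤ x ^ α := Real.rpow_le_rpow_of_exponent_ge hx0 hx1 hαi
  have h2 : x ^ α ≤ y ^ α := Real.rpow_le_rpow hx0.le hxy hα.le
  have h3 : 0 ≤ y ^ α := Real.rpow_nonneg (hx0.le.trans hxy) _
  linarith

/-- `2 x^{α₁} m ≤ 2 y^α` for `0 < x ≤ 1`, `m ≤ 1`, `x ≤ y`, `0 < α ≤ α₁`. [folklore] -/
theorem two_mul_rpow_mul_le {x y m α α₁ : ℝ} (hx0 : 0 < x) (hx1 : x ≤ 1)
    (hm1 : m ≤ 1) (hα : 0 < α) (hα₁ : α ≤ α₁) (hxy : x ≤ y) :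
    2 * x ^ α₁ * m ≤ 2 * y ^ α := by
  have h1 : x ^ α₁ ≤ x ^ α := Real.rpow_le_rpow_of_exponent_ge hx0 hx1 hα₁
  have h2 : x ^ α ≤ y ^ α := Real.rpow_le_rpow hx0.le hxy hα.le
  have h4 : 0 ≤ x ^ α₁ := Real.rpow_nonneg hx0.le _
  have h5 : x ^ α₁ * m ≤ x ^ α₁ * 1 := mul_le_mul_of_nonneg_left hm1 h4
  nlinarith

/-- `2 x^{α₁} m ≤ 2 y^α` for `0 < x ≤ 1`, `0 < z ≤ 1`, `0 ≤ m ≤ z^{α₄}`, `x z ≤ y`,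
`0 < α ≤ α₁, α₄` (the product form of sub-case (iii)). [folklore] -/
theorem two_mul_rpow_mul_le_of_le_rpow {x y z m α α₁ α₄ : ℝ} (hx0 : 0 < x) (hx1 : x ≤ 1)
    (hz0 : 0 < z) (hz1 : z ≤ 1) (hm0 : 0 ≤ m) (hmz : m ≤ z ^ α₄) (hα : 0 < α) (hα₁ : α ≤ α₁)
    (hα₄ : α ≤ α₄) (hxz : x * z ≤ y) : 2 * x ^ α₁ * m ≤ 2 * y ^ α := by
  have h1 : x ^ α₁ ≤ x ^ α := Real.rpow_le_rpow_of_exponent_ge hx0 hx1 hα₁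
  have h2 : z ^ α₄ ≤ z ^ α := Real.rpow_le_rpow_of_exponent_ge hz0 hz1 hα₄
  have h3 : x ^ α₁ * m ≤ x ^ α * z ^ α :=
    mul_le_mul h1 (hmz.trans h2) hm0 (Real.rpow_nonneg hx0.le _)
  have h4 : x ^ α * z ^ α ≤ y ^ α := by
    rw [← Real.mul_rpow hx0.le hz0.le]
    exact Real.rpow_le_rpow (by positivity) hxz hα.le
  nlinarith

/-- The base of sub-case (ii) at scale `K ρ / c'`. [folklore] -/
theorem tame_all_arith_A {C₂ c' c Cf K ρ d : ℝ} (hC₂ : 0 < C₂) (hc' : 0 < c') (hd : 0 < d)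
    (hKρ : 0 < K * ρ) (hρc : K * ρ ≤ c * d) (hc2 : c ≤ c' / C₂) (hCf : C₂ / c' ≤ Cf) :
    0 < C₂ * (K * ρ / c') / d ∧ C₂ * (K * ρ / c') / d ≤ 1 ∧
      C₂ * (K * ρ / c') / d ≤ Cf * K * ρ / d := by
  have heq : C₂ * (K * ρ / c') / d = (C₂ / c') * (K * ρ) / d := by field_simp
  rw [heq]
  refine ⟨by positivity, ?_, ?_⟩
  · rw [div_le_one hd]
    calc C₂ / c' * (K * ρ) ≤ C₂ / c' * (c * d) := by gcongr
      _ ≤ C₂ / c' * (c' / C₂ * d) := by gcongr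
      _ = d := by field_simp
  · apply div_le_div_of_nonneg_right _ hd.le
    calc C₂ / c' * (K * ρ) ≤ Cf * (K * ρ) := by gcongr
      _ = Cf * K * ρ := by ring

/-- The base of the sub-case `d₀ ≤ ρ`. [folklore] -/
theorem tame_all_arith_B1 {C₃ c Cf K ρ d : ℝ} (hC₃ : 0 < C₃) (hd : 0 < d) (hρ : 0 < ρ)
    (hK : 1 ≤ K) (hρc : K * ρ ≤ c * d) (hc3 : c ≤ 1 / C₃) (hCf : C₃ ≤ Cf) :
    0 < C₃ * ρ / d ∧ C₃ * ρ / d ≤ 1 ∧ C₃ * ρ / d ≤ Cf * K * ρ / d := by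
  have hρK : ρ ≤ K * ρ := by nlinarith
  refine ⟨by positivity, ?_, ?_⟩
  · rw [div_le_one hd]
    calc C₃ * ρ ≤ C₃ * (K * ρ) := by gcongr
      _ ≤ C₃ * (c * d) := by gcongr
      _ ≤ C₃ * (1 / C₃ * d) := by gcongr
      _ = d := by field_simp
  · apply div_le_div_of_nonneg_right _ hd.le
    calc C₃ * ρ ≤ Cf * ρ := by gcongr
      _ ≤ Cf * (K * ρ) := by gcongr; exact hC₃.le.trans hCf
      _ = Cf * K * ρ := by ring

/-- The base of the lowest-crossing factor. [folklore] -/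
theorem tame_all_arith_B2 {C₁ c' K ρ d₁ : ℝ} (hC₁ : 0 < C₁) (hd₁ : 0 < d₁) (hKρ : 0 < K * ρ)
    (hKρd₁ : K * ρ < c' * d₁) (hC₁c' : C₁ * c' ≤ 1) :
    0 < C₁ * K * ρ / d₁ ∧ C₁ * K * ρ / d₁ ≤ 1 := by
  have hnum : 0 < C₁ * K * ρ := by rw [mul_assoc]; exact mul_pos hC₁ hKρ
  refine ⟨div_pos hnum hd₁, ?_⟩
  rw [div_le_one hd₁]
  calc C₁ * K * ρ = C₁ * (K * ρ) := by ring
    _ ≤ C₁ * (c' * d₁) := by gcongr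
    _ = (C₁ * c') * d₁ := by ring
    _ ≤ 1 * d₁ := by gcongr
    _ = d₁ := one_mul _
set_option maxHeartbeats 400000 in
/-- **Schramm–Smirnov Lemma 6.1, case (2), tame quads, all sub-cases** (see the module docstring):
there are `α, C, c > 0` such that for every pair `(Q, Q')` satisfying condition (2) at scale `ρ`
and the tameness hypotheses of `QuadCrossingContinuityCaseTwoTame.lean` with constant `K ≥ 1`, in the
regime `K ρ ≤ c · d(Q)` (`d(Q) = max{d₀(Q), d₁(Q)}`), for every mesh `0 < η < ρ`,
`μ_η(⊞_Q Δ ⊞_{Q'}) ≤ 2 (C K ρ / d(Q))^α`.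
[cite: SchrammSmirnov2011, Lemma 6.1 (2) and its proof, (i)–(iii), eq. (6.1)–(6.5)] -/
theorem real_symmDiff_crossedEvent_le_of_isPerturbationTwo_of_tame_all :
    ∃ α C c : ℝ, 0 < α ∧ 0 < C ∧ 0 < c ∧
      ∀ (D : Set ℂ) (Q Q' : Quad D) (ρ K : ℝ), 0 < ρ → 1 ≤ K → K * ρ ≤ c * Q.sizeParam →
        Q.IsPerturbationTwo Q' ρ →
        (∀ η : ℝ, 0 < η → η < ρ → ∀ a b : Site 2, (zdGraph 2).Adj a b →
          IsPreconnected (segment ℝ (meshPoint (η * Real.sqrt 2) a) (meshPoint (η * Real.sqrt 2) b) ∩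
            Q.carrier)) →
        (∀ s t : unitInterval, dist (Q' (1, s)) (Q' (1, t)) ≤ ρ → ∀ u : unitInterval,
          ((s : ℝ) ≤ u ∧ (u : ℝ) ≤ t ∨ (t : ℝ) ≤ u ∧ (u : ℝ) ≤ s) →
            dist (Q' (1, u)) (Q' (1, s)) ≤ K * ρ) →
        (∀ x ∈ Q'.side 2, ∃ r > 0, ∀ u ∈ Q'.carrier, u ∈ ball x r → segment ℝ x u ⊆ Q'.carrier) →
        (∃ ζ : ℝ, (∀ t : unitInterval, (t : ℝ) ≤ ζ → ∀ y ∈ Q.side 3, ∀ p : Path (Q' (1, t)) y,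
            range p ⊆ Q.carrier → Q.sideDist 1 / 4 ≤ Metric.diam (range p)) ∧
          (∀ t : unitInterval, ζ ≤ (t : ℝ) → ∀ y ∈ Q.side 1, ∀ p : Path (Q' (1, t)) y,
            range p ⊆ Q.carrier → Q.sideDist 1 / 4 ≤ Metric.diam (range p))) →
        ∀ η : ℝ, 0 < η → η < ρ →
          (squareCrossingLaw D η : Measure (QuadConfig D)).real
              (symmDiff (QuadConfig.crossedEvent Q) (QuadConfig.crossedEvent Q')) ≤
            2 * ((C * K * ρ) / Q.sizeParam) ^ α := by
  -- the four ingredients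
  obtain ⟨α₁, C₁, c₁, hα₁, hC₁, hc₁, hT⟩ := measureReal_symmDiff_le_mul_of_isPerturbationTwo_of_tame
  obtain ⟨α₂, C₂, c₂, hα₂, hC₂, hc₂, hS⟩ :=
    real_symmDiff_crossedEvent_le_of_isPerturbationTwo_of_sideDist_one_le
  obtain ⟨α₃, C₃, c₃, hα₃, hC₃, hc₃, hZ⟩ :=
    real_symmDiff_crossedEvent_le_of_isPerturbationTwo_of_sideDist_zero_le
  obtain ⟨α₄, c₀, hα₄, hc₀, hRSW⟩ := annulusOpenCrossing_half_le_holds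
  -- constants
  set C₆ : ℝ := 5 + 2 * c₀ with hC₆
  have hC₆pos : 0 < C₆ := by rw [hC₆]; linarith
  set C₄ : ℝ := 32 * C₆ with hC₄
  have hC₄pos : 0 < C₄ := by rw [hC₄]; positivity
  set C₅ : ℝ := 64 * C₆ with hC₅
  have hC₅pos : 0 < C₅ := by rw [hC₅]; positivity
  have hC₄C₅ : C₄ ≤ C₅ := by rw [hC₄, hC₅]; linarith
  -- the threshold constant `c'`
  set c' : ℝ := min (min c₁ c₃) (min C₁⁻¹ 1) with hc'
  have hc'pos : 0 < c' := by rw [hc']; exact lt_min (lt_min hc₁ hc₃) (lt_min (inv_pos.2 hC₁) one_pos)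
  have hc'c₁ : c' ≤ c₁ := by rw [hc']; exact (min_le_left _ _).trans (min_le_left _ _)
  have hc'c₃ : c' ≤ c₃ := by rw [hc']; exact (min_le_left _ _).trans (min_le_right _ _)
  have hc'C₁ : c' ≤ C₁⁻¹ := by rw [hc']; exact (min_le_right _ _).trans (min_le_left _ _)
  have hc'1 : c' ≤ 1 := by rw [hc']; exact (min_le_right _ _).trans (min_le_right _ _)
  have hc'C₁' : C₁ * c' ≤ 1 := by
    have := mul_le_mul_of_nonneg_left hc'C₁ hC₁.le
    rwa [mul_inv_cancel₀ hC₁.ne'] at this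
  -- the exponent and the constant of the conclusion
  set α : ℝ := min (min α₁ α₂) (min α₃ α₄) with hαdef
  have hαpos : 0 < α := by rw [hαdef]; exact lt_min (lt_min hα₁ hα₂) (lt_min hα₃ hα₄)
  have hαα₁ : α ≤ α₁ := by rw [hαdef]; exact (min_le_left _ _).trans (min_le_left _ _)
  have hαα₂ : α ≤ α₂ := by rw [hαdef]; exact (min_le_left _ _).trans (min_le_right _ _)
  have hαα₃ : α ≤ α₃ := by rw [hαdef]; exact (min_le_right _ _).trans (min_le_left _ _)
  have hαα₄ : α ≤ α₄ := by rw [hαdef]; exact (min_le_right _ _).trans (min_le_right _ _)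
  set Cf : ℝ := max (max (C₂ / c') C₃) (C₁ * C₅) with hCf
  have hCf₂ : C₂ / c' ≤ Cf := by rw [hCf]; exact (le_max_left _ _).trans (le_max_left _ _)
  have hCf₃ : C₃ ≤ Cf := by rw [hCf]; exact (le_max_right _ _).trans (le_max_left _ _)
  have hCf₅ : C₁ * C₅ ≤ Cf := by rw [hCf]; exact le_max_right _ _
  have hCfpos : 0 < Cf := lt_of_lt_of_le (div_pos hC₂ hc'pos) hCf₂
  -- the regime constant `c`
  set c : ℝ := min (min (c' * c₂) (c' / C₂)) (min (min (1 / C₃) (1 / (C₁ * C₅))) (min (1 / 64) (c' / 2)))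
    with hcdef
  have hcpos : 0 < c := by
    rw [hcdef]
    refine lt_min (lt_min (mul_pos hc'pos hc₂) (div_pos hc'pos hC₂))
      (lt_min (lt_min ?_ ?_) (lt_min ?_ ?_))
    · positivity
    · positivity
    · norm_num
    · positivity
  have hc_1 : c ≤ c' * c₂ := by rw [hcdef]; exact (min_le_left _ _).trans (min_le_left _ _)
  have hc_2 : c ≤ c' / C₂ := by rw [hcdef]; exact (min_le_left _ _).trans (min_le_right _ _)
  have hc_3 : c ≤ 1 / C₃ := by
    rw [hcdef]; exact (min_le_right _ _).trans ((min_le_left _ _).trans (min_le_left _ _))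
  have hc_4 : c ≤ 1 / (C₁ * C₅) := by
    rw [hcdef]; exact (min_le_right _ _).trans ((min_le_left _ _).trans (min_le_right _ _))
  have hc_5 : c ≤ 1 / 64 := by
    rw [hcdef]; exact (min_le_right _ _).trans ((min_le_right _ _).trans (min_le_left _ _))
  have hc_6 : c ≤ c' / 2 := by
    rw [hcdef]; exact (min_le_right _ _).trans ((min_le_right _ _).trans (min_le_right _ _))
  refine ⟨α, Cf, c, hαpos, hCfpos, hcpos, ?_⟩
  intro D Q Q' ρ K hρ hK hρc h2 htame harc hstar hcut η hη hηρ
  have hd₀pos : 0 < Q.sideDist 0 := Q.sideDist_pos 0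
  have hd₁pos : 0 < Q.sideDist 1 := Q.sideDist_pos 1
  have hdpos : 0 < Q.sizeParam := Q.sizeParam_pos
  have hdmax : Q.sizeParam = max (Q.sideDist 0) (Q.sideDist 1) := rfl
  have hKpos : 0 < K := by linarith
  have hKρpos : 0 < K * ρ := mul_pos hKpos hρ
  have hρKρ : ρ ≤ K * ρ := le_mul_of_one_le_left hρ.le hK
  -- Case A: `d₁ ≤ K ρ / c'` — sub-case (ii) at scale `K ρ / c'`
  have hρ₂pos : 0 < K * ρ / c' := div_pos hKρpos hc'pos
  have hρρ₂ : ρ ≤ K * ρ / c' := by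
    rw [le_div_iff₀ hc'pos]
    calc ρ * c' ≤ ρ * 1 := by gcongr
      _ ≤ K * ρ := by linarith
  have hcc' : c < c' := by linarith
  by_cases hA : Q.sideDist 1 ≤ K * ρ / c'
  · -- here `d = d₀`
    have hlt : Q.sideDist 1 < Q.sizeParam := by
      have h1 : Q.sideDist 1 * c' ≤ K * ρ := (le_div_iff₀ hc'pos).1 hA
      have h2 : c * Q.sizeParam < c' * Q.sizeParam := mul_lt_mul_of_pos_right hcc' hdpos
      nlinarith
    have hdd₀ : Q.sizeParam = Q.sideDist 0 := by
      rw [hdmax] at hlt ⊢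
      rcases le_total (Q.sideDist 0) (Q.sideDist 1) with h | h
      · rw [max_eq_right h] at hlt; exact absurd hlt (lt_irrefl _)
      · exact max_eq_left h
    have hρ₂c : K * ρ / c' ≤ c₂ * Q.sideDist 0 := by
      rw [← hdd₀, div_le_iff₀ hc'pos]
      calc K * ρ ≤ c * Q.sizeParam := hρc
        _ ≤ (c' * c₂) * Q.sizeParam := by gcongr
        _ = c₂ * Q.sizeParam * c' := by ring
    have hmain := hS D Q Q' (K * ρ / c') hρ₂pos hρ₂c (h2.mono hρρ₂) hA η hη (hηρ.trans_le hρρ₂)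
    refine hmain.trans ?_
    rw [← hdd₀]
    obtain ⟨hx0, hx1, hxle⟩ := tame_all_arith_A hC₂ hc'pos hdpos hKρpos hρc hc_2 hCf₂
    exact rpow_le_two_mul_rpow hx0 hx1 hαpos hαα₂ hxle
  -- Case B: `d₁ > K ρ / c'`, i.e. `K ρ < c' d₁`
  push Not at hA
  have hKρd₁ : K * ρ < c' * Q.sideDist 1 := by
    have := (div_lt_iff₀ hc'pos).1 hA; linarith
  have hρd₁ : ρ < Q.sideDist 1 := by
    have : c' * Q.sideDist 1 ≤ 1 * Q.sideDist 1 := mul_le_mul_of_nonneg_right hc'1 hd₁pos.le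
    linarith
  by_cases hB1 : Q.sideDist 0 ≤ ρ
  · -- Case B1: `d₀ ≤ ρ` — the fixed-centre closed arm; here `d = d₁`
    have hdd₁ : Q.sizeParam = Q.sideDist 1 := by
      rw [hdmax]; exact max_eq_right (by linarith)
    have hρc₃ : ρ ≤ c₃ * Q.sideDist 1 := by
      have : c' * Q.sideDist 1 ≤ c₃ * Q.sideDist 1 := mul_le_mul_of_nonneg_right hc'c₃ hd₁pos.le
      linarith
    have hmain := hZ D Q Q' ρ hρ hρc₃ h2 hB1 η hη hηρ
    refine hmain.trans ?_
    rw [← hdd₁]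
    have hρc' : K * ρ ≤ c * Q.sizeParam := hρc
    obtain ⟨hx0, hx1, hxle⟩ := tame_all_arith_B1 hC₃ hdpos hρ hK hρc' hc_3 hCf₃
    exact rpow_le_two_mul_rpow hx0 hx1 hαpos hαα₃ hxle
  -- Case B2: `ρ < d₀` — the lowest-crossing theorem, product form
  push Not at hB1
  have hKρc₁ : K * ρ ≤ c₁ * Q.sideDist 1 := by
    have : c' * Q.sideDist 1 ≤ c₁ * Q.sideDist 1 := mul_le_mul_of_nonneg_right hc'c₁ hd₁pos.le
    linarith
  have hprod := hT D Q Q' ρ K hρ hK hKρc₁ hB1 h2 htame harc hstar hcut η hη hηρ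
  refine (real_squareCrossingLaw_symmDiff_le D η Q Q').trans (hprod.trans ?_)
  set μ := bondPercolation (zdGraph 2) half with hμ
  set B : Set (BondConfig (Site 2)) := {ω | Q' ∈ z2QuadConfig D (η * Real.sqrt 2) ω} with hB
  have hB0 : 0 ≤ μ.real B := measureReal_nonneg
  have hB1' : μ.real B ≤ 1 := measureReal_le_one
  obtain ⟨hy0, hy1⟩ := tame_all_arith_B2 hC₁ hd₁pos hKρpos hKρd₁ hc'C₁'
  by_cases hB2 : Q.sideDist 0 ≤ C₅ * Q.sideDist 1
  · -- Case B2a: `d₀ ≤ C₅ d₁`, hence `d ≤ C₅ d₁`; drop the factor `P(⊞_{Q'}) ≤ 1`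
    have hd₁C₅ : Q.sideDist 1 ≤ C₅ * Q.sideDist 1 := by
      have : 1 * Q.sideDist 1 ≤ C₅ * Q.sideDist 1 :=
        mul_le_mul_of_nonneg_right (by rw [hC₅]; linarith) hd₁pos.le
      linarith
    have hdC₅ : Q.sizeParam ≤ C₅ * Q.sideDist 1 := by rw [hdmax]; exact max_le hB2 hd₁C₅
    have hxle : C₁ * K * ρ / Q.sideDist 1 ≤ Cf * K * ρ / Q.sizeParam := by
      rw [div_le_div_iff₀ hd₁pos hdpos]
      calc C₁ * K * ρ * Q.sizeParam ≤ C₁ * K * ρ * (C₅ * Q.sideDist 1) := by gcongr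
        _ = (C₁ * C₅) * K * ρ * Q.sideDist 1 := by ring
        _ ≤ Cf * K * ρ * Q.sideDist 1 := by gcongr
    exact two_mul_rpow_mul_le hy0 hy1 hB1' hαpos hαα₁ hxle
  -- Case B2b: `d₀ > C₅ d₁` — multiply by the a-priori bound `P(⊞_{Q'}) ≤ (C₄ d₁ / d₀)^α₄`
  push Not at hB2
  have hC₆d : 64 * (C₆ * Q.sideDist 1) < Q.sideDist 0 := by
    have : C₅ * Q.sideDist 1 = 64 * (C₆ * Q.sideDist 1) := by rw [hC₅]; ring
    linarith
  have hC₆d₁ : 5 * Q.sideDist 1 ≤ C₆ * Q.sideDist 1 :=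
    mul_le_mul_of_nonneg_right (by rw [hC₆]; linarith) hd₁pos.le
  have hd₁d₀ : 320 * Q.sideDist 1 < Q.sideDist 0 := by linarith
  have hdd₀ : Q.sizeParam = Q.sideDist 0 := by
    rw [hdmax]; exact max_eq_left (by linarith)
  -- the mesh
  have hδ'pos : 0 < η * Real.sqrt 2 := mul_pos hη (Real.sqrt_pos.2 (by norm_num))
  have hsqrt2 : Real.sqrt 2 < 2 := by
    rw [show (2 : ℝ) = Real.sqrt 4 by rw [show (4 : ℝ) = 2 ^ 2 by norm_num, Real.sqrt_sq (by norm_num)]]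
    exact Real.sqrt_lt_sqrt (by norm_num) (by norm_num)
  have hδ'ρ : η * Real.sqrt 2 < 2 * ρ := by
    calc η * Real.sqrt 2 < ρ * 2 := mul_lt_mul'' hηρ hsqrt2 hη.le (Real.sqrt_nonneg _)
      _ = 2 * ρ := by ring
  have hρd₀ : 64 * ρ ≤ Q.sideDist 0 := by
    have hh : K * ρ ≤ c * Q.sideDist 0 := by rw [← hdd₀]; exact hρc
    have hc64 : c * Q.sideDist 0 ≤ (1 / 64) * Q.sideDist 0 :=
      mul_le_mul_of_nonneg_right hc_5 hd₀pos.le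
    linarith
  -- the a-priori bound
  obtain ⟨hcar, h0, h1, h3, hjoin⟩ := h2
  obtain ⟨x₁, hx₁, x₃, hx₃, τ, hτ, hτdiam⟩ := Q.exists_transversal_diam_lt
  have hD₁ : Metric.diam (range τ) ≤ 2 * Q.sideDist 1 := hτdiam.le
  have hDR : 2 * Q.sideDist 1 + ρ < Q.sideDist 0 / 16 := by linarith
  have hR2 : 2 * (Q.sideDist 0 / 16) < Q.sideDist 0 - ρ := by linarith
  set r₄ : ℝ := max (2 * Q.sideDist 1 + ρ + η * Real.sqrt 2) (c₀ * (η * Real.sqrt 2)) with hr₄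
  have hBE : B ⊆ annulusOpenCrossing x₁ (η * Real.sqrt 2) r₄ (Q.sideDist 0 / 16 - η * Real.sqrt 2) :=
      fun ω hω => by
    rw [hB, mem_setOf_eq, mem_z2QuadConfig_iff_exists_isCrossing hδ'pos] at hω
    obtain ⟨K₀, hK₀, hK₀O⟩ := hω
    exact annulusOpenCrossing_mono_left x₁ _ (le_max_left _ _) _
      (Quad.mem_annulusOpenCrossing_of_isCrossing_inner hδ'pos hρ.le hcar h0 hjoin hx₁ hx₃ τ hτ hD₁
        hDR hR2 hK₀ hK₀O)
  have hr₄δ : c₀ * (η * Real.sqrt 2) ≤ r₄ := le_max_right _ _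
  have hc₀δ : c₀ * (η * Real.sqrt 2) ≤ c₀ * (2 * Q.sideDist 1) :=
    mul_le_mul_of_nonneg_left (by linarith) hc₀.le
  have hr₄le : r₄ ≤ C₆ * Q.sideDist 1 := by
    have hC₆eq : C₆ * Q.sideDist 1 = 5 * Q.sideDist 1 + c₀ * (2 * Q.sideDist 1) := by rw [hC₆]; ring
    rw [hr₄, max_le_iff, hC₆eq]
    have hc₀d₁ : 0 ≤ c₀ * (2 * Q.sideDist 1) := by positivity
    constructor
    · linarith
    · linarith
  have hR'ge : Q.sideDist 0 / 32 ≤ Q.sideDist 0 / 16 - η * Real.sqrt 2 := by linarith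
  have h2r₄ : 2 * r₄ ≤ Q.sideDist 0 / 16 - η * Real.sqrt 2 := by linarith
  have hr₄pos : 0 < r₄ := lt_of_lt_of_le (by positivity) (le_max_right _ _)
  have hapriori : μ.real B ≤ (C₄ * Q.sideDist 1 / Q.sideDist 0) ^ α₄ := by
    have hmono : μ.real B ≤
        μ.real (annulusOpenCrossing x₁ (η * Real.sqrt 2) r₄ (Q.sideDist 0 / 16 - η * Real.sqrt 2)) :=
      measureReal_mono hBE (measure_ne_top _ _)
    refine hmono.trans ((hRSW x₁ _ r₄ _ hδ'pos hr₄δ h2r₄).trans ?_)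
    have hbase : r₄ / (Q.sideDist 0 / 16 - η * Real.sqrt 2) ≤ C₄ * Q.sideDist 1 / Q.sideDist 0 := by
      rw [div_le_div_iff₀ (by linarith) hd₀pos]
      have h1 : r₄ * Q.sideDist 0 ≤ (C₆ * Q.sideDist 1) * Q.sideDist 0 :=
        mul_le_mul_of_nonneg_right hr₄le hd₀pos.le
      have h2 : (C₆ * Q.sideDist 1) * (Q.sideDist 0 / 32) ≤
          (C₆ * Q.sideDist 1) * (Q.sideDist 0 / 16 - η * Real.sqrt 2) :=
        mul_le_mul_of_nonneg_left hR'ge (by positivity)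
      have h3 : C₄ * Q.sideDist 1 * (Q.sideDist 0 / 16 - η * Real.sqrt 2) =
          32 * ((C₆ * Q.sideDist 1) * (Q.sideDist 0 / 16 - η * Real.sqrt 2)) := by rw [hC₄]; ring
      rw [h3]
      linarith
    exact Real.rpow_le_rpow (div_nonneg hr₄pos.le (by linarith)) hbase hα₄.le
  -- the base of the second factor `≤ 1`, and the product of the two bases
  have hz0 : 0 < C₄ * Q.sideDist 1 / Q.sideDist 0 := by positivity
  have hz1 : C₄ * Q.sideDist 1 / Q.sideDist 0 ≤ 1 := by
    rw [div_le_one hd₀pos]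
    have : C₄ * Q.sideDist 1 = 32 * (C₆ * Q.sideDist 1) := by rw [hC₄]; ring
    linarith
  have hxz : C₁ * K * ρ / Q.sideDist 1 * (C₄ * Q.sideDist 1 / Q.sideDist 0) ≤
      Cf * K * ρ / Q.sizeParam := by
    have heq : C₁ * K * ρ / Q.sideDist 1 * (C₄ * Q.sideDist 1 / Q.sideDist 0) =
        (C₁ * C₄) * K * ρ / Q.sizeParam := by
      rw [hdd₀]; field_simp
    rw [heq]
    apply div_le_div_of_nonneg_right _ hdpos.le
    have hCf : C₁ * C₄ ≤ Cf :=
      calc C₁ * C₄ ≤ C₁ * C₅ := by gcongr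
        _ ≤ Cf := hCf₅
    calc C₁ * C₄ * K * ρ = (C₁ * C₄) * (K * ρ) := by ring
      _ ≤ Cf * (K * ρ) := by gcongr
      _ = Cf * K * ρ := by ring
  exact two_mul_rpow_mul_le_of_le_rpow hy0 hy1 hz0 hz1 hB0 hapriori hαpos hαα₁ hαα₄ hxz

end QuadCrossing

end Literature.Probability.Percolation
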